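import Mathlib
import Summits.QuantumFields.YangMills.Theorems.TwistEaterVolumeTauberLaplace
import Summits.QuantumFields.YangMills.Theses.TwistEaterVolume

/-!
# Uniform two-sided Tauberian sandwich — support item `TwistEaterVolume.TauberUniform` ⟨stmt-QuantumFields-24321⟩ BY NAME (part 2; part 1 = `TwistEaterVolumeTauberLaplace.lean`: layer cake and Gamma tails)

Free-hands work of the LEAD seat `ym-line-sfw-p2` (gen 74) for planner `ym-idea-4`'s LINE g15-A
(route `TwistEaterVolume`, DRAFT by design) and the «tauber» skeleton on crux ⟨24204⟩
`VirialFluxGap.SharpTwistedLaplace`: the elementary, dimension-explicit ABELIAN/TAUBERIAN transfer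

  power-law small-ball volumes `μ{F ≤ t} = v·t^N·(1 ± κt)` on `(0,t₀]` for a probability measure
  ⟹ `|log ∫ e^{−βF} dμ − (log v + log N! − N·log β)| ≤ (4κ(N+1)+4)/β`

as soon as `β ≥ 2`, `β ≥ 2(κ(N+1)+1)` and `64(N+2)²(1 + |log v| + |log t₀| + log β) ≤ β·t₀`.

Proof: layer cake `∫ e^{−βF} dμ = ∫_{s>0} βe^{−βs}·μ{F ≤ s} ds` (Mathlib's
`lintegral_comp_eq_lintegral_meas_lt_mul` with `g t = βe^{−βt}` and the complement rule of a
probability space); the main term is `v·N!/β^N·(1 ± κ(N+1)/β)` (Gamma integrals); the truncation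
tail `∫_{s>t₀} s^N e^{−βs} ds ≤ (2/β)·t₀^N·e^{−βt₀/2}` (from `s/t₀ ≤ e^{s/t₀−1}` and `2N ≤ βt₀`) and the
far tail `≤ e^{−βt₀}` are both `≤ (v·N!/β^N)/β` on the stated window; finally `|log(1 ± δ)| ≤ 2δ` for
`δ = (κ(N+1)+1)/β ≤ 1/2`.  The stated constant `(4κ(N+1)+4)/β` has a factor-two margin.

HONEST LABEL: a support item (pure measure theory / real analysis) of a DRAFT-by-design sub-route;
no crux, rung or summit statement is proved here; the Yang–Mills mass gap is NOT proved by this.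
-/

noncomputable section

namespace Summit.QuantumFields.YangMills.Theorems.TwistEaterVolume.Tauber

open MeasureTheory Set Filter Real
open scoped Nat Topology

/-! ## Window arithmetic: what `64(N+2)²(1+|log v|+|log t₀|+log β) ≤ βt₀` buys -/

section Window

variable {N : ℕ} {v t₀ β : ℝ}

/-- The window gives `2N ≤ βt₀`. -/
theorem window_two_mul_le (hβ2 : 2 ≤ β)
    (hwin : 64 * ((N : ℝ) + 2) ^ 2 * (1 + |Real.log v| + |Real.log t₀| + Real.log β) ≤ β * t₀) :
    2 * (N : ℝ) ≤ β * t₀ := by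
  have hlogβ : 0 ≤ Real.log β := log_nonneg (by linarith)
  have hS : 1 ≤ 1 + |Real.log v| + |Real.log t₀| + Real.log β := by
    linarith [abs_nonneg (Real.log v), abs_nonneg (Real.log t₀)]
  have hN0 : (0 : ℝ) ≤ N := Nat.cast_nonneg N
  nlinarith [hS, hN0, sq_nonneg ((N : ℝ) + 2)]

/-- The window gives the FAR-TAIL bound `e^{−βt₀} ≤ (v·N!/β^N)/β`. -/
theorem window_far_tail (hv : 0 < v) (hβ2 : 2 ≤ β)
    (hwin : 64 * ((N : ℝ) + 2) ^ 2 * (1 + |Real.log v| + |Real.log t₀| + Real.log β) ≤ β * t₀) :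
    rexp (-(β * t₀)) ≤ v * N ! / β ^ N / β := by
  have hβ : 0 < β := by linarith
  have hlogβ : 0 ≤ Real.log β := log_nonneg (by linarith)
  have hN0 : (0 : ℝ) ≤ N := Nat.cast_nonneg N
  have hfact : (1 : ℝ) ≤ N ! := by exact_mod_cast Nat.one_le_iff_ne_zero.mpr (Nat.factorial_ne_zero N)
  -- the exponent comparison
  have hS0 : 0 ≤ 1 + |Real.log v| + |Real.log t₀| + Real.log β := by
    linarith [abs_nonneg (Real.log v), abs_nonneg (Real.log t₀)]
  have h64 : (N : ℝ) + 1 ≤ 64 * ((N : ℝ) + 2) ^ 2 := by nlinarith [hN0]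
  have h1 : ((N : ℝ) + 1) * (1 + |Real.log v| + |Real.log t₀| + Real.log β) ≤ β * t₀ :=
    le_trans (mul_le_mul_of_nonneg_right h64 hS0) hwin
  have h2 : -(β * t₀) ≤ Real.log v + Real.log (N ! : ℝ) - N * Real.log β - Real.log β := by
    have hlv : -Real.log v ≤ |Real.log v| := neg_le_abs _
    have hlfact : 0 ≤ Real.log (N ! : ℝ) := log_nonneg hfact
    nlinarith [h1, hlv, hlfact, abs_nonneg (Real.log t₀), hN0, hlogβ, abs_nonneg (Real.log v)]
  have hpos : 0 < v * N ! / β ^ N / β := by positivity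
  rw [← Real.le_log_iff_exp_le hpos]
  rw [Real.log_div (by positivity) hβ.ne', Real.log_div (by positivity) (by positivity),
    Real.log_mul hv.ne' (by positivity), Real.log_pow]
  exact h2

/-- The window gives the TRUNCATION-TAIL bound `2·v·t₀^N·e^{−βt₀/2} ≤ (v·N!/β^N)/β`. -/
theorem window_truncation_tail (hv : 0 < v) (ht₀ : 0 < t₀) (hβ2 : 2 ≤ β)
    (hwin : 64 * ((N : ℝ) + 2) ^ 2 * (1 + |Real.log v| + |Real.log t₀| + Real.log β) ≤ β * t₀) :
    2 * v * t₀ ^ N * rexp (-(β * t₀ / 2)) ≤ v * N ! / β ^ N / β := by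
  have hβ : 0 < β := by linarith
  have hxpos : 0 < β * t₀ := by positivity
  have hlogβ : 0 ≤ Real.log β := log_nonneg (by linarith)
  have hN0 : (0 : ℝ) ≤ N := Nat.cast_nonneg N
  have hfact : (1 : ℝ) ≤ N ! := by
    exact_mod_cast Nat.one_le_iff_ne_zero.mpr (Nat.factorial_ne_zero N)
  have hS1 : 1 + Real.log β ≤ 1 + |Real.log v| + |Real.log t₀| + Real.log β := by
    linarith [abs_nonneg (Real.log v), abs_nonneg (Real.log t₀)]
  -- (a) `(βt₀)^N ≤ exp(βt₀/4)` because `N log(βt₀) ≤ 2N√(βt₀) ≤ βt₀/4` (as `64N² ≤ βt₀`)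
  have hx64 : 64 * (N : ℝ) ^ 2 ≤ β * t₀ := by
    have : 64 * (N : ℝ) ^ 2 ≤
        64 * ((N : ℝ) + 2) ^ 2 * (1 + |Real.log v| + |Real.log t₀| + Real.log β) := by
      nlinarith [hS1, hlogβ, hN0]
    linarith
  have hsqrt : 8 * (N : ℝ) ≤ Real.sqrt (β * t₀) := by
    rw [Real.le_sqrt (by positivity) hxpos.le]; nlinarith [hx64]
  have hlogx : Real.log (β * t₀) ≤ 2 * Real.sqrt (β * t₀) := by
    have h := Real.log_le_rpow_div hxpos.le (by norm_num : (0:ℝ) < 1 / 2)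
    rw [← Real.sqrt_eq_rpow] at h
    linarith
  have hNlog : (N : ℝ) * Real.log (β * t₀) ≤ β * t₀ / 4 := by
    have hsx : Real.sqrt (β * t₀) * Real.sqrt (β * t₀) = β * t₀ := Real.mul_self_sqrt hxpos.le
    nlinarith [hlogx, hsqrt, Real.sqrt_nonneg (β * t₀), hN0]
  have ha : (β * t₀) ^ N ≤ rexp (β * t₀ / 4) := by
    have : (β * t₀) ^ N = rexp ((N : ℝ) * Real.log (β * t₀)) := by
      rw [← Real.rpow_natCast, Real.rpow_def_of_pos hxpos, mul_comm]
    rw [this]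
    exact exp_le_exp.2 hNlog
  -- (b) `2β ≤ exp(βt₀/4)` because `log 2 + log β ≤ 1 + log β ≤ βt₀/256`
  have hb : 2 * β ≤ rexp (β * t₀ / 4) := by
    have h2β : 2 * β = rexp (Real.log 2 + Real.log β) := by
      rw [Real.exp_add, Real.exp_log (by norm_num), Real.exp_log hβ]
    rw [h2β]
    refine exp_le_exp.2 ?_
    have hlog2 : Real.log 2 ≤ 1 := by
      have := Real.log_le_sub_one_of_pos (by norm_num : (0:ℝ) < 2); linarith
    have : 256 * (1 + Real.log β) ≤ β * t₀ := by
      have : 256 * (1 + Real.log β) ≤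
          64 * ((N : ℝ) + 2) ^ 2 * (1 + |Real.log v| + |Real.log t₀| + Real.log β) := by
        nlinarith [hS1, hlogβ, hN0]
      linarith
    linarith
  -- combine: `2(βt₀)^N β e^{−βt₀/2} ≤ e^{βt₀/4} e^{βt₀/4} e^{−βt₀/2} = 1 ≤ N!`
  have hkey : 2 * (β * t₀) ^ N * β * rexp (-(β * t₀ / 2)) ≤ 1 := by
    have hprod : 2 * (β * t₀) ^ N * β ≤ rexp (β * t₀ / 4) * rexp (β * t₀ / 4) := by
      calc 2 * (β * t₀) ^ N * β = (β * t₀) ^ N * (2 * β) := by ring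
        _ ≤ rexp (β * t₀ / 4) * rexp (β * t₀ / 4) :=
            mul_le_mul ha hb (by positivity) (exp_nonneg _)
    have hE : rexp (β * t₀ / 4) * rexp (β * t₀ / 4) * rexp (-(β * t₀ / 2)) = 1 := by
      have h0 : β * t₀ / 4 + β * t₀ / 4 + -(β * t₀ / 2) = 0 := by ring
      rw [← Real.exp_add, ← Real.exp_add, h0, Real.exp_zero]
    calc 2 * (β * t₀) ^ N * β * rexp (-(β * t₀ / 2))
          ≤ rexp (β * t₀ / 4) * rexp (β * t₀ / 4) * rexp (-(β * t₀ / 2)) :=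
          mul_le_mul_of_nonneg_right hprod (exp_nonneg _)
      _ = 1 := hE
  rw [le_div_iff₀ hβ, le_div_iff₀ (pow_pos hβ N)]
  calc 2 * v * t₀ ^ N * rexp (-(β * t₀ / 2)) * β * β ^ N
        = v * (2 * (β * t₀) ^ N * β * rexp (-(β * t₀ / 2))) := by rw [mul_pow]; ring
    _ ≤ v * 1 := mul_le_mul_of_nonneg_left hkey hv.le
    _ ≤ v * N ! := mul_le_mul_of_nonneg_left hfact hv.le

end Window

/-! ## From a two-sided multiplicative sandwich to a log estimate -/

/-- If `M(1−δ) ≤ I ≤ M(1+δ)` with `M > 0` and `0 ≤ δ ≤ 1/2`, then `|log I − log M| ≤ 2δ`. -/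
theorem abs_log_sub_log_le_of_sandwich {I M δ : ℝ} (hM : 0 < M) (hδ0 : 0 ≤ δ) (hδ : δ ≤ 1 / 2)
    (hL : M * (1 - δ) ≤ I) (hU : I ≤ M * (1 + δ)) :
    |Real.log I - Real.log M| ≤ 2 * δ := by
  have hM1 : 0 < M * (1 - δ) := by nlinarith
  have hIpos : 0 < I := lt_of_lt_of_le hM1 hL
  rw [abs_sub_le_iff]
  constructor
  · have h1 : Real.log I ≤ Real.log (M * (1 + δ)) := Real.log_le_log hIpos hU
    rw [Real.log_mul hM.ne' (by linarith)] at h1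
    have h2 : Real.log (1 + δ) ≤ δ := by
      have := Real.log_le_sub_one_of_pos (by linarith : (0:ℝ) < 1 + δ); linarith
    linarith
  · have h1 : Real.log (M * (1 - δ)) ≤ Real.log I := Real.log_le_log hM1 hL
    rw [Real.log_mul hM.ne' (by linarith)] at h1
    have h3 : 1 - (1 - δ)⁻¹ ≤ Real.log (1 - δ) := Real.one_sub_inv_le_log_of_pos (by linarith)
    have h4 : (1 - δ)⁻¹ ≤ 1 + 2 * δ := by
      rw [inv_eq_one_div, div_le_iff₀ (by linarith)]; nlinarith
    linarith

/-! ## The sandwich -/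

/-- MAIN THEOREM (explicit hypotheses) — UNIFORM TWO-SIDED TAUBERIAN SANDWICH: for a probability
measure `μ`, a measurable `F ≥ 0` with `|μ{F ≤ t}/(v·t^N) − 1| ≤ κ·t` on `(0, t₀]`, and every
`β ≥ 2` with `2(κ(N+1)+1) ≤ β` and `64(N+2)²(1 + |log v| + |log t₀| + log β) ≤ β·t₀`:
`|log ∫ e^{−βF} dμ − (log v + log N! − N·log β)| ≤ (4κ(N+1)+4)/β`. -/
theorem tauber_sandwich {Ω : Type*} [MeasurableSpace Ω] (μ : Measure Ω) [IsProbabilityMeasure μ]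
    (F : Ω → ℝ) (N : ℕ) (v κ t₀ : ℝ) (hF : Measurable F) (hF0 : ∀ ω, 0 ≤ F ω) (hv : 0 < v)
    (ht₀ : 0 < t₀) (hκ : 0 ≤ κ)
    (hvol : ∀ t : ℝ, 0 < t → t ≤ t₀ → |μ.real {ω | F ω ≤ t} / (v * t ^ N) - 1| ≤ κ * t)
    {β : ℝ} (hβ2 : 2 ≤ β) (hβκ : 2 * (κ * (N + 1) + 1) ≤ β)
    (hwin : 64 * ((N : ℝ) + 2) ^ 2 * (1 + |Real.log v| + |Real.log t₀| + Real.log β) ≤ β * t₀) :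
    |Real.log (∫ ω, rexp (-(β * F ω)) ∂μ) - (Real.log v + Real.log (N ! : ℝ) - N * Real.log β)|
      ≤ (4 * κ * (N + 1) + 4) / β := by
  have hβ : 0 < β := by linarith
  have hN0 : (0:ℝ) ≤ N := Nat.cast_nonneg N
  have hfact_succ : ((N + 1) ! : ℝ) = (N + 1) * N ! := by
    push_cast [Nat.factorial_succ]; ring
  -- the pieces
  have hI := integral_exp_neg_mul_eq_integral_sublevel (μ := μ) F hF hF0 hβ
  have hintgG := integrableOn_mul_exp_neg_mul_mul_sublevel (μ := μ) F hβ
  have hφN := integrableOn_pow_mul_exp_neg_mul_Ioi N hβ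
  have hφN1 := integrableOn_pow_mul_exp_neg_mul_Ioi (N + 1) hβ
  -- split the layer-cake integral at `t₀`
  have hsplit : ∫ s in Ioi 0, β * rexp (-(β * s)) * μ.real {ω | F ω ≤ s}
      = (∫ s in Ioc 0 t₀, β * rexp (-(β * s)) * μ.real {ω | F ω ≤ s})
        + ∫ s in Ioi t₀, β * rexp (-(β * s)) * μ.real {ω | F ω ≤ s} := by
    rw [← setIntegral_union (Ioc_disjoint_Ioi le_rfl) measurableSet_Ioi
      (hintgG.mono_set Ioc_subset_Ioi_self) (hintgG.mono_set (Ioi_subset_Ioi ht₀.le)),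
      Ioc_union_Ioi_eq_Ioi ht₀.le]
  -- far tail: `0 ≤ J₂ ≤ e^{−βt₀}`
  have hJ2nn : 0 ≤ ∫ s in Ioi t₀, β * rexp (-(β * s)) * μ.real {ω | F ω ≤ s} :=
    setIntegral_nonneg measurableSet_Ioi fun s _ =>
      mul_nonneg (by positivity) measureReal_nonneg
  have hJ2le : ∫ s in Ioi t₀, β * rexp (-(β * s)) * μ.real {ω | F ω ≤ s} ≤ rexp (-(β * t₀)) := by
    calc ∫ s in Ioi t₀, β * rexp (-(β * s)) * μ.real {ω | F ω ≤ s}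
        ≤ ∫ s in Ioi t₀, β * rexp (-(β * s)) :=
          setIntegral_mono_on (hintgG.mono_set (Ioi_subset_Ioi ht₀.le))
            (integrableOn_mul_exp_neg_mul_Ioi hβ t₀) measurableSet_Ioi
            fun s _ => mul_le_of_le_one_right (by positivity) measureReal_le_one
      _ = rexp (-(β * t₀)) := integral_mul_exp_neg_mul_Ioi hβ t₀
  -- pointwise sandwich on `(0, t₀]`
  have hup : ∀ s ∈ Ioc (0:ℝ) t₀, β * rexp (-(β * s)) * μ.real {ω | F ω ≤ s}
      ≤ β * v * (s ^ N * rexp (-(β * s))) + β * v * κ * (s ^ (N + 1) * rexp (-(β * s))) := by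
    intro s hs
    have hvs : 0 < v * s ^ N := by have := hs.1; positivity
    have h := (abs_sub_le_iff.1 (hvol s hs.1 hs.2)).1
    rw [sub_le_iff_le_add, div_le_iff₀ hvs] at h
    have hg0 : 0 ≤ β * rexp (-(β * s)) := by positivity
    calc β * rexp (-(β * s)) * μ.real {ω | F ω ≤ s}
        ≤ β * rexp (-(β * s)) * ((κ * s + 1) * (v * s ^ N)) := mul_le_mul_of_nonneg_left h hg0
      _ = β * v * (s ^ N * rexp (-(β * s))) + β * v * κ * (s ^ (N + 1) * rexp (-(β * s))) := by
          ring
  have hlo : ∀ s ∈ Ioc (0:ℝ) t₀,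
      β * v * (s ^ N * rexp (-(β * s))) - β * v * κ * (s ^ (N + 1) * rexp (-(β * s)))
      ≤ β * rexp (-(β * s)) * μ.real {ω | F ω ≤ s} := by
    intro s hs
    have hvs : 0 < v * s ^ N := by have := hs.1; positivity
    have h := (abs_sub_le_iff.1 (hvol s hs.1 hs.2)).2
    rw [sub_le_comm, le_div_iff₀ hvs] at h
    have hg0 : 0 ≤ β * rexp (-(β * s)) := by positivity
    calc β * v * (s ^ N * rexp (-(β * s))) - β * v * κ * (s ^ (N + 1) * rexp (-(β * s)))
        = β * rexp (-(β * s)) * ((1 - κ * s) * (v * s ^ N)) := by ring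
      _ ≤ β * rexp (-(β * s)) * μ.real {ω | F ω ≤ s} := mul_le_mul_of_nonneg_left h hg0
  -- integrate the sandwich over `(0, t₀]`
  have hiN : IntegrableOn (fun s : ℝ => β * v * (s ^ N * rexp (-(β * s)))) (Ioc 0 t₀) :=
    (hφN.mono_set Ioc_subset_Ioi_self).const_mul (β * v)
  have hiN1 : IntegrableOn (fun s : ℝ => β * v * κ * (s ^ (N + 1) * rexp (-(β * s)))) (Ioc 0 t₀) :=
    (hφN1.mono_set Ioc_subset_Ioi_self).const_mul (β * v * κ)
  have hiU : IntegrableOn (fun s : ℝ => β * v * (s ^ N * rexp (-(β * s)))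
      + β * v * κ * (s ^ (N + 1) * rexp (-(β * s)))) (Ioc 0 t₀) := hiN.add hiN1
  have hiL : IntegrableOn (fun s : ℝ => β * v * (s ^ N * rexp (-(β * s)))
      - β * v * κ * (s ^ (N + 1) * rexp (-(β * s)))) (Ioc 0 t₀) := hiN.sub hiN1
  have hJ1le : ∫ s in Ioc 0 t₀, β * rexp (-(β * s)) * μ.real {ω | F ω ≤ s}
      ≤ β * v * (∫ s in Ioc 0 t₀, s ^ N * rexp (-(β * s)))
        + β * v * κ * (∫ s in Ioc 0 t₀, s ^ (N + 1) * rexp (-(β * s))) := by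
    have h := setIntegral_mono_on (hintgG.mono_set Ioc_subset_Ioi_self) hiU
      measurableSet_Ioc hup
    rw [integral_add hiN hiN1, integral_const_mul, integral_const_mul] at h
    exact h
  have hJ1ge : β * v * (∫ s in Ioc 0 t₀, s ^ N * rexp (-(β * s)))
        - β * v * κ * (∫ s in Ioc 0 t₀, s ^ (N + 1) * rexp (-(β * s)))
      ≤ ∫ s in Ioc 0 t₀, β * rexp (-(β * s)) * μ.real {ω | F ω ≤ s} := by
    have h := setIntegral_mono_on hiL (hintgG.mono_set Ioc_subset_Ioi_self)
      measurableSet_Ioc hlo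
    rw [integral_sub hiN hiN1, integral_const_mul, integral_const_mul] at h
    exact h
  -- Gamma-integral bounds on `(0, t₀]`
  have hA_N : ∫ s in Ioc 0 t₀, s ^ N * rexp (-(β * s)) ≤ N ! / β ^ (N + 1) := by
    rw [← intervalIntegral.integral_of_le ht₀.le]
    exact intervalIntegral_pow_mul_exp_neg_le ht₀.le hβ
  have hA_N1 : ∫ s in Ioc 0 t₀, s ^ (N + 1) * rexp (-(β * s)) ≤ (N + 1) ! / β ^ (N + 1 + 1) := by
    rw [← intervalIntegral.integral_of_le ht₀.le]
    exact intervalIntegral_pow_mul_exp_neg_le ht₀.le hβ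
  have h2N : 2 * (N:ℝ) ≤ β * t₀ := window_two_mul_le hβ2 hwin
  have hA_Nge : N ! / β ^ (N + 1) - 2 / β * t₀ ^ N * rexp (-(β * t₀ / 2))
      ≤ ∫ s in Ioc 0 t₀, s ^ N * rexp (-(β * s)) := by
    have hsplit' : ∫ s in Ioi 0, s ^ N * rexp (-(β * s))
        = (∫ s in Ioc 0 t₀, s ^ N * rexp (-(β * s))) + ∫ s in Ioi t₀, s ^ N * rexp (-(β * s)) := by
      rw [← setIntegral_union (Ioc_disjoint_Ioi le_rfl) measurableSet_Ioi
        (hφN.mono_set Ioc_subset_Ioi_self) (hφN.mono_set (Ioi_subset_Ioi ht₀.le)),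
        Ioc_union_Ioi_eq_Ioi ht₀.le]
    have htail := integral_Ioi_pow_mul_exp_neg_mul_le N hβ ht₀ h2N
    have hfull := integral_pow_mul_exp_neg_mul_Ioi N hβ
    linarith
  -- window consequences
  have hW1 := window_far_tail (N := N) hv hβ2 hwin
  have hW2 := window_truncation_tail (N := N) hv ht₀ hβ2 hwin
  -- algebra: everything in units of `M = v·N!/β^N`
  obtain ⟨M, hM⟩ : ∃ M : ℝ, M = v * N ! / β ^ N := ⟨_, rfl⟩
  have hMpos : 0 < M := by rw [hM]; positivity
  rw [← hM] at hW1 hW2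
  have hE1 : β * v * (N ! / β ^ (N + 1)) = M := by
    rw [hM]; field_simp; ring
  have hE2 : β * v * κ * ((N + 1) ! / β ^ (N + 1 + 1)) = M * (κ * (N + 1) / β) := by
    rw [hM, hfact_succ]; field_simp; ring
  have hE3 : β * v * (2 / β * t₀ ^ N * rexp (-(β * t₀ / 2)))
      = 2 * v * t₀ ^ N * rexp (-(β * t₀ / 2)) := by
    field_simp
  obtain ⟨δ, hδ⟩ : ∃ δ : ℝ, δ = (κ * (N + 1) + 1) / β := ⟨_, rfl⟩
  have hδ0 : 0 ≤ δ := by rw [hδ]; positivity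
  have hδhalf : δ ≤ 1 / 2 := by
    rw [hδ, div_le_iff₀ hβ]; linarith
  have hMδ : M * δ = M * (κ * (N + 1) / β) + M / β := by rw [hδ]; ring
  -- upper bound `I ≤ M(1+δ)`
  have hU : ∫ ω, rexp (-(β * F ω)) ∂μ ≤ M * (1 + δ) := by
    have h1 : β * v * (∫ s in Ioc 0 t₀, s ^ N * rexp (-(β * s))) ≤ β * v * (N ! / β ^ (N + 1)) :=
      mul_le_mul_of_nonneg_left hA_N (by positivity)
    have h2 : β * v * κ * (∫ s in Ioc 0 t₀, s ^ (N + 1) * rexp (-(β * s)))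
        ≤ β * v * κ * ((N + 1) ! / β ^ (N + 1 + 1)) :=
      mul_le_mul_of_nonneg_left hA_N1 (by positivity)
    rw [hI, hsplit]
    linarith [hJ1le, hJ2le, h1, h2, hE1, hE2, hW1, hMδ]
  -- lower bound `M(1−δ) ≤ I`
  have hL : M * (1 - δ) ≤ ∫ ω, rexp (-(β * F ω)) ∂μ := by
    have h1 : β * v * (N ! / β ^ (N + 1) - 2 / β * t₀ ^ N * rexp (-(β * t₀ / 2)))
        ≤ β * v * (∫ s in Ioc 0 t₀, s ^ N * rexp (-(β * s))) :=
      mul_le_mul_of_nonneg_left hA_Nge (by positivity)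
    have h2 : β * v * κ * (∫ s in Ioc 0 t₀, s ^ (N + 1) * rexp (-(β * s)))
        ≤ β * v * κ * ((N + 1) ! / β ^ (N + 1 + 1)) :=
      mul_le_mul_of_nonneg_left hA_N1 (by positivity)
    have hdist : β * v * (N ! / β ^ (N + 1) - 2 / β * t₀ ^ N * rexp (-(β * t₀ / 2)))
        = β * v * (N ! / β ^ (N + 1)) - β * v * (2 / β * t₀ ^ N * rexp (-(β * t₀ / 2))) := by
      ring
    rw [hI, hsplit]
    linarith [hJ1ge, hJ2nn, h1, h2, hE1, hE2, hE3, hW2, hMδ, hdist]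
  -- logs
  have key := abs_log_sub_log_le_of_sandwich hMpos hδ0 hδhalf hL hU
  have hlogM : Real.log M = Real.log v + Real.log (N ! : ℝ) - N * Real.log β := by
    rw [hM, Real.log_div (by positivity) (by positivity), Real.log_mul hv.ne' (by positivity),
      Real.log_pow]
  have h2δ : 2 * δ ≤ (4 * κ * (N + 1) + 4) / β := by
    rw [hδ]
    have : (4 * κ * ((N:ℝ) + 1) + 4) / β
        = 2 * ((κ * (N + 1) + 1) / β) + (2 * κ * (N + 1) + 2) / β := by ring
    rw [this]
    have : 0 ≤ (2 * κ * ((N:ℝ) + 1) + 2) / β := by positivity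
    linarith
  rw [← hlogM]
  exact key.trans h2δ

end Summit.QuantumFields.YangMills.Theorems.TwistEaterVolume.Tauber


namespace Summit.QuantumFields.YangMills.Theorems.TwistEaterVolume

/-- ★ Support item ⟨stmt-QuantumFields-24321⟩ `TwistEaterVolume.TauberUniform` BY NAME (= the «tauber»
skeleton's `stub_tauberUniform` on crux ⟨24204⟩ `VirialFluxGap.SharpTwistedLaplace`, character-identical
Prop): the uniform two-sided Tauberian sandwich.  No crux, rung or summit is proved by this; the
Yang–Mills mass gap is NOT proved by this. -/
theorem tauberUniform_proof : Summit.QuantumFields.YangMills.Theses.TwistEaterVolume.TauberUniform := by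
  intro Ω _ μ _ F N v κ t₀ hF hF0 hv ht₀ hκ _hκt hvol β hβ2 hβκ hwin
  exact Tauber.tauber_sandwich μ F N v κ t₀ hF hF0 hv ht₀ hκ hvol hβ2 hβκ hwin

end Summit.QuantumFields.YangMills.Theorems.TwistEaterVolume

end
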